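import Literature.Barriers.RiemannHypothesis.GramRosserFailures
import Literature.NumberTheory.LFunctions.RiemannSiegelStirling
import Literature.NumberTheory.LFunctions.RiemannSiegelThetaBounds
import HarnessLib

/-!
# Gram points exist and are unique (`g ≥ 10`): proof of `Edwards1974_gramPoint_existsUnique`

Sibling of `Literature/Barriers/RiemannHypothesis/GramRosserFailures.lean`, which vendors
"the `n`th Gram point `g_n` is the unique real number `≥ 10` with `ϑ(g_n) = nπ`" (Edwards,
*Riemann's Zeta Function*, §6.5) as the named fact
`Literature.Barriers.RiemannHypothesis.Edwards1974_gramPoint_existsUnique`. Edwards: "`ϑ` is increasing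
for `t ≥ 10` (roughly)… `ϑ(g_n) = nπ` has a unique solution". Here this is **proved**:

* `Literature.Barriers.RiemannHypothesis.riemannSiegelThetaDeriv_ge` — from the second-order Stirling bound for `Re ψ`
  (`Literature.NumberTheory.LFunctions.Complex.abs_re_digamma_sub_log_norm_add_re_le`, `RiemannSiegelStirling.lean`):
  `θ'(u) ≥ ½ log(u/2π) − (1/(4u²) + 2/(3u³) + π/(6u²))` for `u ≥ 2`, whence
  `Literature.Barriers.RiemannHypothesis.riemannSiegelThetaDeriv_pos_of_seven_le` (`θ' > 0` on `[7, ∞)`; the tree's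
  `riemannSiegelThetaDeriv_pos` covers `[4π, ∞)`) and `Literature.strictMonoOn_riemannSiegelTheta_Ici`
  (`θ` strictly increasing on `[7, ∞)`);
* `Literature.Barriers.RiemannHypothesis.riemannSiegelTheta_ten_lt` — `θ(10) < −2` from the explicit Stirling bound
  `Literature.NumberTheory.LFunctions.abs_riemannSiegelTheta_sub_stirling_le`;
* `Edwards1974_gramPoint_existsUnique_holds` — existence by the intermediate value theorem on
  `[10, T]` (`θ(10) < 0 ≤ nπ`, `θ → ∞`, `Literature.NumberTheory.LFunctions.tendsto_riemannSiegelTheta_atTop`), uniqueness by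
  strict monotonicity.

## References

* H. M. Edwards, *Riemann's Zeta Function*, Academic Press 1974, §6.5 (Gram points; `g_0 = 17.845…`).
* E. C. Titchmarsh, *The Theory of the Riemann Zeta-Function*, 2nd ed. (1986), §4.17 (`ϑ`), §10.6
  (Gram points).
-/

noncomputable section

open Complex Real Set Filter Topology

namespace Literature.Barriers.RiemannHypothesis

/-- **Lower bound for `θ'`**: for `u ≥ 2`,
`θ'(u) ≥ ½ log(u/2π) − (1/(4u²) + 2/(3u³) + π/(6u²))` (`θ'(u) = ½ Re ψ(¼ + iu/2) − ½ log π`, the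
second-order Stirling bound at `w = ¼ + iu/2`, `log ‖w‖ ≥ log(u/2)`, `Re 1/(2w) ≤ 1/(2u²)`).
[folklore] -/
theorem riemannSiegelThetaDeriv_ge {u : ℝ} (hu : 2 ≤ u) :
    Real.log (u / (2 * π)) / 2 - (1 / (4 * u ^ 2) + 2 / (3 * u ^ 3) + π / (6 * u ^ 2)) ≤
      Literature.NumberTheory.LFunctions.riemannSiegelThetaDeriv u := by
  have hu0 : 0 < u := by linarith
  have hπ := Real.pi_pos
  set w : ℂ := 1 / 4 + (u : ℂ) / 2 * I with hw
  have hwre : w.re = 1 / 4 := by simp [hw]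
  have hwim : w.im = u / 2 := by simp [hw]
  have hu2 : (0 : ℝ) < u / 2 := by positivity
  have h1 := Literature.NumberTheory.LFunctions.Complex.abs_re_digamma_sub_log_norm_add_re_le (w := w) (by rw [hwre]; norm_num)
    (by rw [hwim]; exact hu2.ne')
  rw [hwim, abs_of_pos hu2] at h1
  -- `log ‖w‖ ≥ log (u/2)`
  have hnorm : u / 2 ≤ ‖w‖ := by
    have := abs_im_le_norm w
    rwa [hwim, abs_of_pos (by positivity)] at this
  have hlog : Real.log (u / 2) ≤ Real.log ‖w‖ := Real.log_le_log (by positivity) hnorm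
  -- `Re 1/(2w) ≤ 1/(2u²)`
  have hB : (1 / (2 * w)).re = (1 / 4) / (2 * ((1 / 4) ^ 2 + (u / 2) ^ 2)) := by
    have hden : (1 / 4 : ℝ) ^ 2 + (u / 2) ^ 2 ≠ 0 := by positivity
    rw [one_div, Complex.inv_re, Complex.normSq_apply]
    simp [hw]
    field_simp
  have hB1 : (1 / (2 * w)).re ≤ 1 / (2 * u ^ 2) := by
    rw [hB, div_le_div_iff₀ (by positivity) (by positivity)]
    nlinarith
  -- the value of `θ'`
  have hθ : Literature.NumberTheory.LFunctions.riemannSiegelThetaDeriv u = (digamma w).re / 2 - Real.log π / 2 := by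
    rw [Literature.NumberTheory.LFunctions.riemannSiegelThetaDeriv]
  have hlog2 : Real.log (u / (2 * π)) = Real.log (u / 2) - Real.log π := by
    rw [← Real.log_div (by positivity) hπ.ne', div_div]
  have herr : 1 / (6 * (u / 2) ^ 3) + π / (12 * (u / 2) ^ 2) = 4 / (3 * u ^ 3) + π / (3 * u ^ 2) := by
    field_simp
    ring
  rw [herr] at h1
  have h2 := (abs_le.1 h1).1
  have key : Real.log (u / 2) - 1 / (2 * u ^ 2) - (4 / (3 * u ^ 3) + π / (3 * u ^ 2)) ≤
      (digamma w).re := by linarith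
  have t1 : (1 : ℝ) / (2 * u ^ 2) / 2 = 1 / (4 * u ^ 2) := by field_simp; ring
  have t2 : (4 : ℝ) / (3 * u ^ 3) / 2 = 2 / (3 * u ^ 3) := by field_simp; ring
  have t3 : π / (3 * u ^ 2) / 2 = π / (6 * u ^ 2) := by field_simp; ring
  rw [hθ, hlog2, ← t1, ← t2, ← t3]
  linarith

/-- **`θ'(u) > 0` for `u ≥ 7`** (Edwards §6.5: "`ϑ` is increasing for `t ≥ 10` (roughly)"; indeed
for `t ≥ 6.29…`). Since `7/(2π) > 1.11`, `½ log(7/2π) > 0.05 > 1/(4·49) + 2/(3·343) + π/(6·49)`.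
[cite: Edwards1974, §6.5] -/
theorem riemannSiegelThetaDeriv_pos_of_seven_le {u : ℝ} (hu : 7 ≤ u) :
    0 < Literature.NumberTheory.LFunctions.riemannSiegelThetaDeriv u := by
  have hπ3 : π < 3.1416 := Real.pi_lt_d4
  have hπ0 : 3 < π := Real.pi_gt_three
  have hu0 : 0 < u := by linarith
  have h := riemannSiegelThetaDeriv_ge (u := u) (by linarith)
  -- lower bound for the logarithm: `log x ≥ 1 − 1/x` at `x = u/(2π) ≥ 7/(2π)`
  have hx : 7 / (2 * π) ≤ u / (2 * π) := div_le_div_of_nonneg_right hu (by positivity)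
  have hx0 : 0 < 7 / (2 * π) := by positivity
  have hlog : 1 - (2 * π) / 7 ≤ Real.log (u / (2 * π)) := by
    have h1 := Real.one_sub_inv_le_log_of_pos (x := u / (2 * π)) (by positivity)
    have h2 : (u / (2 * π))⁻¹ ≤ (7 / (2 * π))⁻¹ := by
      rw [inv_le_inv₀ (by positivity) hx0]; exact hx
    simp only [inv_div] at h1 h2
    linarith
  -- the error terms are small for `u ≥ 7`
  have e1 : 1 / (4 * u ^ 2) ≤ 1 / (4 * 7 ^ 2) := by
    apply div_le_div_of_nonneg_left (by norm_num) (by positivity); nlinarith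
  have e2 : 2 / (3 * u ^ 3) ≤ 2 / (3 * 7 ^ 3) := by
    apply div_le_div_of_nonneg_left (by norm_num) (by positivity); nlinarith
  have e3 : π / (6 * u ^ 2) ≤ π / (6 * 7 ^ 2) := by
    apply div_le_div_of_nonneg_left (by positivity) (by positivity); nlinarith
  nlinarith

/-- **`θ` is strictly increasing on `[7, ∞)`** (so Gram points `g ≥ 10` are unique).
[cite: Edwards1974, §6.5] -/
theorem strictMonoOn_riemannSiegelTheta_Ici_seven : StrictMonoOn Literature.NumberTheory.LFunctions.riemannSiegelTheta (Ici 7) := by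
  refine strictMonoOn_of_deriv_pos (convex_Ici _)
    (fun x _ ↦ (Literature.NumberTheory.LFunctions.hasDerivAt_riemannSiegelTheta_holds x).continuousAt.continuousWithinAt) ?_
  intro x hx
  rw [interior_Ici] at hx
  rw [(Literature.NumberTheory.LFunctions.hasDerivAt_riemannSiegelTheta_holds x).deriv]
  exact riemannSiegelThetaDeriv_pos_of_seven_le (le_of_lt hx)

/-- **`θ(10) < −2`** (Edwards: `θ(g_0) = 0` at `g_0 = 17.845…`; `θ(10) = −3.06…`), from the explicit
Stirling bound with `K(¼) < 0.6` and `log(10/2π) ≤ 10/(2π) − 1 < 2/3`. [cite: Edwards1974, §6.5] -/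
theorem riemannSiegelTheta_ten_lt : Literature.NumberTheory.LFunctions.riemannSiegelTheta 10 < -2 := by
  have hπ0 : 3 < π := Real.pi_gt_three
  have hπ3 : π < 3.1416 := Real.pi_lt_d4
  have h := Literature.NumberTheory.LFunctions.abs_riemannSiegelTheta_sub_stirling_le (t := 10) (by norm_num)
  have hK : Literature.NumberTheory.LFunctions.stirlingVertRate (1 / 4) < 0.6 := by
    rw [Literature.NumberTheory.LFunctions.stirlingVertRate]; nlinarith
  have hlog : Real.log (10 / (2 * π)) ≤ 10 / (2 * π) - 1 :=
    Real.log_le_sub_one_of_pos (by positivity)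
  have hπ2 : 3.14 < π := Real.pi_gt_d2
  have hq : 10 / (2 * π) < 1.6 := by
    rw [div_lt_iff₀ (by positivity)]; nlinarith
  have h2 := (abs_le.1 h).2
  have hK' : 2 * Literature.NumberTheory.LFunctions.stirlingVertRate (1 / 4) / 10 < 0.12 := by
    rw [div_lt_iff₀ (by norm_num)]; linarith
  nlinarith

/-- **Gram points exist and are unique** — discharge of the vendored fact
`Literature.Barriers.RiemannHypothesis.Edwards1974_gramPoint_existsUnique` (`GramRosserFailures.lean`):
for every `n ≥ 0` there is exactly one `g ≥ 10` with `θ(g) = nπ`. Existence: `θ(10) < 0 ≤ nπ` and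
`θ(T) → ∞`, so the intermediate value theorem applies on `[10, T]`; uniqueness: `θ` is strictly
increasing on `[7, ∞)`. [cite: Edwards1974, §6.5] -/
theorem Edwards1974_gramPoint_existsUnique_holds :
    Literature.Barriers.RiemannHypothesis.Edwards1974_gramPoint_existsUnique := by
  intro n
  have hn : (0 : ℝ) ≤ n * π := by positivity
  have h10 := riemannSiegelTheta_ten_lt
  -- a height `T ≥ 10` with `θ(T) ≥ nπ`
  obtain ⟨T, hT⟩ := (tendsto_atTop_atTop.1 Literature.NumberTheory.LFunctions.tendsto_riemannSiegelTheta_atTop) (n * π)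
  set T' := max T 10 with hT'
  have hT'θ : (n : ℝ) * π ≤ Literature.NumberTheory.LFunctions.riemannSiegelTheta T' := hT T' (le_max_left _ _)
  have h10T' : (10 : ℝ) ≤ T' := le_max_right _ _
  -- IVT
  have hcont : ContinuousOn Literature.NumberTheory.LFunctions.riemannSiegelTheta (Icc 10 T') := fun x _ ↦
    (Literature.NumberTheory.LFunctions.hasDerivAt_riemannSiegelTheta_holds x).continuousAt.continuousWithinAt
  have hmem : (n : ℝ) * π ∈ Icc (Literature.NumberTheory.LFunctions.riemannSiegelTheta 10) (Literature.NumberTheory.LFunctions.riemannSiegelTheta T') :=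
    ⟨by linarith, hT'θ⟩
  obtain ⟨g, hg, hθg⟩ := intermediate_value_Icc h10T' hcont hmem
  refine ⟨g, ⟨hg.1, hθg⟩, ?_⟩
  rintro g' ⟨hg'10, hθg'⟩
  exact strictMonoOn_riemannSiegelTheta_Ici_seven.injOn (show (7 : ℝ) ≤ g' by linarith)
    (show (7 : ℝ) ≤ g by linarith [hg.1]) (hθg'.trans hθg.symm)

end Literature.Barriers.RiemannHypothesis
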